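import Summits.Ventures.PercRepro.Night2NearFatTopPairs
import Summits.Ventures.PercRepro.Night2NonFatLineTwoOne

/-!
# night-2: h21's CELL `(2, 1)` IN THE NON-THREE-PLANAR CASE AT `|G| = 14, 15, 16` (gen 40)

With no fat closure and `V = G ∖ K` not three-planar, the local Hall inequality holds
* at `|G| = 16` when no line of `V` has exactly `9` points (`localShadowHall_ntp_sixteen`): a line with `≥ 10` points leaves
  `≤ 5` points off it (gen 37's `localShadowHall_two_one_of_line`), and with every line `≤ 8` the basis pairs have basis
  lines of `≤ 6` and classes of `≤ 7` points of `W` (`basis_pair_fair_ntp_ten`);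
* at `|G| = 15` when every line has `≤ 6` or `≥ 9` points (`localShadowHall_ntp_fifteen`: `basis_pair_fair_ntp_nine`);
* at `|G| = 14` when every line has `≤ 5` or `≥ 8` points (`localShadowHall_ntp_fourteen`: `basis_pair_fair_ntp_eight`) — and at
  `|G| = 15` and `14` the three-planar hypothesis can be DROPPED (`localShadowHall_fifteen_of_lines`, `localShadowHall_fourteen_of_lines`):
  the family of the top four levels still has income `≥ 1` there, and at those levels every load is a distance-1 load
  (Night2NearFatTop, Night2NearFatTopPairs).
The near-fat hypothesis is not used: these are statements about the non-fat case as a whole.  Paper: proofs/NIGHT-2-g40.md §6.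
-/

namespace PercRepro.Shadow

open PercRepro.ThmH PercRepro.PerFlat

variable {α : Type*} [DecidableEq α] {M : Matroid α} [M.Finite] {G : Finset α}

/-- `|V| = |G| − 1` in the cell `(2, 1)`. -/
theorem card_sdiff_coloops_eq_sub_one (hk : kColoops M G = 1) : (G \ coloops M G).card = G.card - 1 := by
  have hk1 : (coloops M G).card = 1 := by
    rw [← kColoops_eq_card_coloops]
    exact hk
  have hsub : coloops M G ⊆ G := by
    unfold coloops
    exact Finset.filter_subset _ _
  rw [Finset.card_sdiff_of_subset hsub, hk1]

/-- **A long line closes the cell**: a pair `u ≠ v` of `V` whose line carries all but `≤ 5` points of `V`. -/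
theorem localShadowHall_of_long_line (hG : G ∈ flatsQ M (5 + 1)) (hd : (gr M \ G).card = 2)
    (hk : kColoops M G = 1) (hs : ∀ e ∈ gr M, ∀ f ∈ gr M, e ≠ f → rkN M {e, f} = 2)
    (hl : ∀ e ∈ gr M, M.Indep {e}) {u v : α} (hu : u ∈ G \ coloops M G) (hv : v ∈ G \ coloops M G)
    (huv : u ≠ v) (h5 : (G \ coloops M G).card ≤ ((G \ coloops M G) ∩ clF M {u, v}).card + 5) :
    LocalShadowHall M 5 G := by
  have hGg : G ⊆ gr M := (mem_flatsQ.1 hG).1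
  apply localShadowHall_two_one_of_line hG hd hk hs hl (ℓ := (G \ coloops M G) ∩ clF M {u, v})
    Finset.inter_subset_left
  · have h := rkN_le_of_subset_clF' (M := M) (X := (G \ coloops M G) ∩ clF M {u, v}) (Y := {u, v})
      Finset.inter_subset_right
    rw [hs u (hGg (Finset.mem_sdiff.1 hu).1) v (hGg (Finset.mem_sdiff.1 hv).1) huv] at h
    exact h
  · rw [Finset.card_sdiff_of_subset Finset.inter_subset_left]
    omega

/-- The points of `W` on a basis line: two fewer than the points of `V` on it. -/
theorem card_inter_W_add_two_le (hG : G ∈ flatsQ M (5 + 1)) (hd : (gr M \ G).card = 2) {B : Finset α}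
    (hB : B ∈ thinMembers M 5 G)
    {z : α} (hz : z ∈ G \ clF M B) {a b : α} (ha : a ∈ insert z B \ coloops M G)
    (hb : b ∈ insert z B \ coloops M G) (hab : a ≠ b) :
    ((G \ insert z B) ∩ clF M {a, b}).card + 2 ≤ ((G \ coloops M G) ∩ clF M {a, b}).card := by
  have hGg : G ⊆ gr M := (mem_flatsQ.1 hG).1
  have hQG : insert z B ⊆ G := Finset.insert_subset (Finset.mem_sdiff.1 hz).1 (subset_G_of_mem_thinMembers hB)
  have hpair : ({a, b} : Finset α) ⊆ gr M := by
    intro e he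
    rw [Finset.mem_insert, Finset.mem_singleton] at he
    rcases he with rfl | rfl
    · exact hGg (hQG (Finset.mem_sdiff.1 ha).1)
    · exact hGg (hQG (Finset.mem_sdiff.1 hb).1)
  have hsubV : ({a, b} : Finset α) ⊆ (G \ coloops M G) ∩ clF M {a, b} := by
    intro e he
    rw [Finset.mem_inter]
    refine ⟨?_, subset_clF_of_subset_gr hpair he⟩
    rw [Finset.mem_insert, Finset.mem_singleton] at he
    rcases he with rfl | rfl
    · exact Finset.mem_sdiff.2 ⟨hQG (Finset.mem_sdiff.1 ha).1, (Finset.mem_sdiff.1 ha).2⟩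
    · exact Finset.mem_sdiff.2 ⟨hQG (Finset.mem_sdiff.1 hb).1, (Finset.mem_sdiff.1 hb).2⟩
  have hsubW : (G \ insert z B) ∩ clF M {a, b} ⊆ ((G \ coloops M G) ∩ clF M {a, b}) \ {a, b} := by
    intro e he
    rw [Finset.mem_inter, Finset.mem_sdiff] at he
    rw [Finset.mem_sdiff, Finset.mem_inter, Finset.mem_sdiff, Finset.mem_insert, Finset.mem_singleton]
    refine ⟨⟨⟨he.1.1, fun hK => he.1.2 (Finset.mem_insert_of_mem
      (coloops_subset_of_mem_thinMembers hG (by omega) hB hK))⟩, he.2⟩, ?_⟩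
    rintro (rfl | rfl)
    · exact he.1.2 (Finset.mem_sdiff.1 ha).1
    · exact he.1.2 (Finset.mem_sdiff.1 hb).1
  have h := Finset.card_le_card hsubW
  rw [Finset.card_sdiff_of_subset hsubV, Finset.card_pair hab] at h
  have h2 := Finset.card_le_card hsubV
  rw [Finset.card_pair hab] at h2
  omega

/-- The points of `W` on a line through a basis point: one fewer than the points of `V` on it. -/
theorem card_inter_W_add_one_le (hG : G ∈ flatsQ M (5 + 1)) (hd : (gr M \ G).card = 2) {B : Finset α}
    (hB : B ∈ thinMembers M 5 G)
    {z : α} (hz : z ∈ G \ clF M B) {a y : α} (ha : a ∈ insert z B \ coloops M G) (hy : y ∈ G \ insert z B) :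
    ((G \ insert z B) ∩ clF M {a, y}).card + 1 ≤ ((G \ coloops M G) ∩ clF M {a, y}).card := by
  have hGg : G ⊆ gr M := (mem_flatsQ.1 hG).1
  have hQG : insert z B ⊆ G := Finset.insert_subset (Finset.mem_sdiff.1 hz).1 (subset_G_of_mem_thinMembers hB)
  have hpair : ({a, y} : Finset α) ⊆ gr M := by
    intro e he
    rw [Finset.mem_insert, Finset.mem_singleton] at he
    rcases he with rfl | rfl
    · exact hGg (hQG (Finset.mem_sdiff.1 ha).1)
    · exact hGg (Finset.mem_sdiff.1 hy).1
  have haV : a ∈ (G \ coloops M G) ∩ clF M {a, y} :=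
    Finset.mem_inter.2 ⟨Finset.mem_sdiff.2 ⟨hQG (Finset.mem_sdiff.1 ha).1, (Finset.mem_sdiff.1 ha).2⟩,
      subset_clF_of_subset_gr hpair (Finset.mem_insert_self _ _)⟩
  have hsubW : (G \ insert z B) ∩ clF M {a, y} ⊆ ((G \ coloops M G) ∩ clF M {a, y}).erase a := by
    intro e he
    rw [Finset.mem_inter, Finset.mem_sdiff] at he
    rw [Finset.mem_erase, Finset.mem_inter, Finset.mem_sdiff]
    refine ⟨fun h => he.1.2 (h ▸ (Finset.mem_sdiff.1 ha).1), ⟨he.1.1, fun hK => he.1.2 (Finset.mem_insert_of_mem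
      (coloops_subset_of_mem_thinMembers hG (by omega) hB hK))⟩, he.2⟩
  have h := Finset.card_le_card hsubW
  rw [Finset.card_erase_of_mem haV] at h
  have h2 := Finset.card_pos.2 ⟨a, haV⟩
  omega

/-- The non-three-planar case at `|G| = 16`, `15`, `14`: the basis pairs are fair when every line of `V` is short. -/
theorem localShadowHall_ntp_of_short_lines (hG : G ∈ flatsQ M (5 + 1)) (hd : (gr M \ G).card = 2)
    (hk : kColoops M G = 1) (hs : ∀ e ∈ gr M, ∀ f ∈ gr M, e ≠ f → rkN M {e, f} = 2)
    (hl : ∀ e ∈ gr M, M.Indep {e}) (hnf : fatClosures M 5 G 2 = ∅)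
    (hntp : ¬ (∃ R ⊆ G \ coloops M G, rkN M R = 2 ∧ ∃ c ∈ G \ coloops M G, ∃ d ∈ G \ coloops M G,
      ∃ e ∈ G \ coloops M G, G \ coloops M G ⊆ clF M (insert c R) ∪ clF M (insert d R) ∪ clF M (insert e R)))
    {L : ℕ} (hcard : (G.card = 16 ∧ L = 8) ∨ (G.card = 15 ∧ L = 6) ∨ (G.card = 14 ∧ L = 5))
    (hline : ∀ u ∈ G \ coloops M G, ∀ v ∈ G \ coloops M G, u ≠ v → ((G \ coloops M G) ∩ clF M {u, v}).card ≤ L) :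
    LocalShadowHall M 5 G := by
  have hfat : (fatClosures M 5 G 2).card ≤ 1 := by
    rw [hnf, Finset.card_empty]
    exact zero_le_one
  apply localShadowHall_of_gt2_of_basis_fair hG hd hk hs hl hfat
  intro B hB hnP z hz
  by_cases hl0 : loss M 5 G B z = 0
  · rw [hl0]
    have hd' : (gr M \ G).card ≤ 5 := by omega
    have h1 : 0 ≤ rhoL M 5 G B z := by
      unfold rhoL
      rw [hl0]
      simp
    have h2 : 0 ≤ lossIncomeH M 5 G (bigP M G) (dshGT2 M 5 G) B z :=
      lossIncomeH_nonneg hG hd' (column_side_gt2 hG hd hk hs hl hfat) B z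
    positivity
  · have hQG : insert z B ⊆ G := Finset.insert_subset (Finset.mem_sdiff.1 hz).1 (subset_G_of_mem_thinMembers hB)
    have hW := card_sdiff_insert_eq_card_sub_six hG hd hk hB hnP hz
    have hQ'V : ∀ a ∈ insert z B \ coloops M G, a ∈ G \ coloops M G := fun a ha =>
      Finset.mem_sdiff.2 ⟨hQG (Finset.mem_sdiff.1 ha).1, (Finset.mem_sdiff.1 ha).2⟩
    have hWV : ∀ y ∈ G \ insert z B, y ∈ G \ coloops M G := fun y hy =>
      Finset.mem_sdiff.2 ⟨(Finset.mem_sdiff.1 hy).1, fun hK => (Finset.mem_sdiff.1 hy).2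
        (Finset.mem_insert_of_mem (coloops_subset_of_mem_thinMembers hG (by omega) hB hK))⟩
    have h2 : ∀ a ∈ insert z B \ coloops M G, ∀ b ∈ insert z B \ coloops M G, a ≠ b →
        ((G \ insert z B) ∩ clF M {a, b}).card + 2 ≤ L := fun a ha b hb hab =>
      le_trans (card_inter_W_add_two_le hG hd hB hz ha hb hab) (hline a (hQ'V a ha) b (hQ'V b hb) hab)
    have h1 : ∀ a ∈ insert z B \ coloops M G, ∀ y ∈ G \ insert z B,
        ((G \ insert z B) ∩ clF M {a, y}).card + 1 ≤ L := by
      intro a ha y hy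
      have hay : a ≠ y := fun h => (Finset.mem_sdiff.1 hy).2 (h ▸ (Finset.mem_sdiff.1 ha).1)
      exact le_trans (card_inter_W_add_one_le hG hd hB hz ha hy) (hline a (hQ'V a ha) y (hWV y hy) hay)
    rcases hcard with ⟨h16, rfl⟩ | ⟨h15, rfl⟩ | ⟨h14, rfl⟩
    · exact basis_pair_fair_ntp_ten hG hd hk hs hl hnf hntp hB hnP hz hl0 (by omega)
        (fun a ha b hb hab => by have := h2 a ha b hb hab; omega)
        (fun a ha y hy => by have := h1 a ha y hy; omega)
    · exact basis_pair_fair_ntp_nine hG hd hk hs hl hnf hntp hB hnP hz hl0 (by omega)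
        (fun a ha b hb hab => by have := h2 a ha b hb hab; omega)
        (fun a ha y hy => by have := h1 a ha y hy; omega)
    · exact basis_pair_fair_ntp_eight hG hd hk hs hl hnf hntp hB hnP hz hl0 (by omega)
        (fun a ha b hb hab => by have := h2 a ha b hb hab; omega)
        (fun a ha y hy => by have := h1 a ha y hy; omega)

/-- **h21's cell `(2, 1)` at `|G| = 16` in the non-three-planar case**: no fat closure, `V` not three-planar, and no line
of `V` with exactly nine points. -/
theorem localShadowHall_ntp_sixteen (hG : G ∈ flatsQ M (5 + 1)) (hd : (gr M \ G).card = 2)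
    (hk : kColoops M G = 1) (hs : ∀ e ∈ gr M, ∀ f ∈ gr M, e ≠ f → rkN M {e, f} = 2)
    (hl : ∀ e ∈ gr M, M.Indep {e}) (hnf : fatClosures M 5 G 2 = ∅)
    (hntp : ¬ (∃ R ⊆ G \ coloops M G, rkN M R = 2 ∧ ∃ c ∈ G \ coloops M G, ∃ d ∈ G \ coloops M G,
      ∃ e ∈ G \ coloops M G, G \ coloops M G ⊆ clF M (insert c R) ∪ clF M (insert d R) ∪ clF M (insert e R)))
    (h16 : G.card = 16)
    (hline : ∀ u ∈ G \ coloops M G, ∀ v ∈ G \ coloops M G, u ≠ v → ((G \ coloops M G) ∩ clF M {u, v}).card ≠ 9) :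
    LocalShadowHall M 5 G := by
  by_cases hlong : ∃ u ∈ G \ coloops M G, ∃ v ∈ G \ coloops M G, u ≠ v ∧ 10 ≤ ((G \ coloops M G) ∩ clF M {u, v}).card
  · obtain ⟨u, hu, v, hv, huv, h10⟩ := hlong
    apply localShadowHall_of_long_line hG hd hk hs hl hu hv huv
    rw [card_sdiff_coloops_eq_sub_one hk]
    omega
  · push Not at hlong
    apply localShadowHall_ntp_of_short_lines hG hd hk hs hl hnf hntp (Or.inl ⟨h16, rfl⟩)
    intro u hu v hv huv
    have := hlong u hu v hv huv
    have := hline u hu v hv huv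
    omega

/-- **h21's cell `(2, 1)` at `|G| = 15` in the non-three-planar case**: every line of `V` with `≤ 6` or `≥ 9` points. -/
theorem localShadowHall_ntp_fifteen (hG : G ∈ flatsQ M (5 + 1)) (hd : (gr M \ G).card = 2)
    (hk : kColoops M G = 1) (hs : ∀ e ∈ gr M, ∀ f ∈ gr M, e ≠ f → rkN M {e, f} = 2)
    (hl : ∀ e ∈ gr M, M.Indep {e}) (hnf : fatClosures M 5 G 2 = ∅)
    (hntp : ¬ (∃ R ⊆ G \ coloops M G, rkN M R = 2 ∧ ∃ c ∈ G \ coloops M G, ∃ d ∈ G \ coloops M G,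
      ∃ e ∈ G \ coloops M G, G \ coloops M G ⊆ clF M (insert c R) ∪ clF M (insert d R) ∪ clF M (insert e R)))
    (h15 : G.card = 15)
    (hline : ∀ u ∈ G \ coloops M G, ∀ v ∈ G \ coloops M G, u ≠ v →
      ((G \ coloops M G) ∩ clF M {u, v}).card ≤ 6 ∨ 9 ≤ ((G \ coloops M G) ∩ clF M {u, v}).card) :
    LocalShadowHall M 5 G := by
  by_cases hlong : ∃ u ∈ G \ coloops M G, ∃ v ∈ G \ coloops M G, u ≠ v ∧ 9 ≤ ((G \ coloops M G) ∩ clF M {u, v}).card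
  · obtain ⟨u, hu, v, hv, huv, h9⟩ := hlong
    apply localShadowHall_of_long_line hG hd hk hs hl hu hv huv
    rw [card_sdiff_coloops_eq_sub_one hk]
    omega
  · push Not at hlong
    apply localShadowHall_ntp_of_short_lines hG hd hk hs hl hnf hntp (Or.inr (Or.inl ⟨h15, rfl⟩))
    intro u hu v hv huv
    have := hlong u hu v hv huv
    rcases hline u hu v hv huv with h | h
    · exact h
    · omega

/-- **h21's cell `(2, 1)` at `|G| = 14` in the non-three-planar case**: every line of `V` with `≤ 5` or `≥ 8` points. -/
theorem localShadowHall_ntp_fourteen (hG : G ∈ flatsQ M (5 + 1)) (hd : (gr M \ G).card = 2)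
    (hk : kColoops M G = 1) (hs : ∀ e ∈ gr M, ∀ f ∈ gr M, e ≠ f → rkN M {e, f} = 2)
    (hl : ∀ e ∈ gr M, M.Indep {e}) (hnf : fatClosures M 5 G 2 = ∅)
    (hntp : ¬ (∃ R ⊆ G \ coloops M G, rkN M R = 2 ∧ ∃ c ∈ G \ coloops M G, ∃ d ∈ G \ coloops M G,
      ∃ e ∈ G \ coloops M G, G \ coloops M G ⊆ clF M (insert c R) ∪ clF M (insert d R) ∪ clF M (insert e R)))
    (h14 : G.card = 14)
    (hline : ∀ u ∈ G \ coloops M G, ∀ v ∈ G \ coloops M G, u ≠ v →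
      ((G \ coloops M G) ∩ clF M {u, v}).card ≤ 5 ∨ 8 ≤ ((G \ coloops M G) ∩ clF M {u, v}).card) :
    LocalShadowHall M 5 G := by
  by_cases hlong : ∃ u ∈ G \ coloops M G, ∃ v ∈ G \ coloops M G, u ≠ v ∧ 8 ≤ ((G \ coloops M G) ∩ clF M {u, v}).card
  · obtain ⟨u, hu, v, hv, huv, h8⟩ := hlong
    apply localShadowHall_of_long_line hG hd hk hs hl hu hv huv
    rw [card_sdiff_coloops_eq_sub_one hk]
    omega
  · push Not at hlong
    apply localShadowHall_ntp_of_short_lines hG hd hk hs hl hnf hntp (Or.inr (Or.inr ⟨h14, rfl⟩))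
    intro u hu v hv huv
    have := hlong u hu v hv huv
    rcases hline u hu v hv huv with h | h
    · exact h
    · omega

/-- The top-level case at `|G| = 15`, `14`: the basis pairs are fair when every line of `V` is short, with no three-planar
hypothesis. -/
theorem localShadowHall_top_of_short_lines (hG : G ∈ flatsQ M (5 + 1)) (hd : (gr M \ G).card = 2)
    (hk : kColoops M G = 1) (hs : ∀ e ∈ gr M, ∀ f ∈ gr M, e ≠ f → rkN M {e, f} = 2)
    (hl : ∀ e ∈ gr M, M.Indep {e}) (hnf : fatClosures M 5 G 2 = ∅)
    {L : ℕ} (hcard : (G.card = 15 ∧ L = 6) ∨ (G.card = 14 ∧ L = 5))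
    (hline : ∀ u ∈ G \ coloops M G, ∀ v ∈ G \ coloops M G, u ≠ v → ((G \ coloops M G) ∩ clF M {u, v}).card ≤ L) :
    LocalShadowHall M 5 G := by
  have hfat : (fatClosures M 5 G 2).card ≤ 1 := by
    rw [hnf, Finset.card_empty]
    exact zero_le_one
  apply localShadowHall_of_gt2_of_basis_fair hG hd hk hs hl hfat
  intro B hB hnP z hz
  by_cases hl0 : loss M 5 G B z = 0
  · rw [hl0]
    have hd' : (gr M \ G).card ≤ 5 := by omega
    have h1 : 0 ≤ rhoL M 5 G B z := by
      unfold rhoL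
      rw [hl0]
      simp
    have h2 : 0 ≤ lossIncomeH M 5 G (bigP M G) (dshGT2 M 5 G) B z :=
      lossIncomeH_nonneg hG hd' (column_side_gt2 hG hd hk hs hl hfat) B z
    positivity
  · have hQG : insert z B ⊆ G := Finset.insert_subset (Finset.mem_sdiff.1 hz).1 (subset_G_of_mem_thinMembers hB)
    have hW := card_sdiff_insert_eq_card_sub_six hG hd hk hB hnP hz
    have hQ'V : ∀ a ∈ insert z B \ coloops M G, a ∈ G \ coloops M G := fun a ha =>
      Finset.mem_sdiff.2 ⟨hQG (Finset.mem_sdiff.1 ha).1, (Finset.mem_sdiff.1 ha).2⟩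
    have hWV : ∀ y ∈ G \ insert z B, y ∈ G \ coloops M G := fun y hy =>
      Finset.mem_sdiff.2 ⟨(Finset.mem_sdiff.1 hy).1, fun hK => (Finset.mem_sdiff.1 hy).2
        (Finset.mem_insert_of_mem (coloops_subset_of_mem_thinMembers hG (by omega) hB hK))⟩
    have h2 : ∀ a ∈ insert z B \ coloops M G, ∀ b ∈ insert z B \ coloops M G, a ≠ b →
        ((G \ insert z B) ∩ clF M {a, b}).card + 2 ≤ L := fun a ha b hb hab =>
      le_trans (card_inter_W_add_two_le hG hd hB hz ha hb hab) (hline a (hQ'V a ha) b (hQ'V b hb) hab)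
    have h1 : ∀ a ∈ insert z B \ coloops M G, ∀ y ∈ G \ insert z B,
        ((G \ insert z B) ∩ clF M {a, y}).card + 1 ≤ L := by
      intro a ha y hy
      have hay : a ≠ y := fun h => (Finset.mem_sdiff.1 hy).2 (h ▸ (Finset.mem_sdiff.1 ha).1)
      exact le_trans (card_inter_W_add_one_le hG hd hB hz ha hy) (hline a (hQ'V a ha) y (hWV y hy) hay)
    rcases hcard with ⟨h15, rfl⟩ | ⟨h14, rfl⟩
    · exact basis_pair_fair_top_nine hG hd hk hs hl hnf hB hnP hz hl0 (by omega)
        (fun a ha b hb hab => by have := h2 a ha b hb hab; omega)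
        (fun a ha y hy => by have := h1 a ha y hy; omega)
    · exact basis_pair_fair_top_eight hG hd hk hs hl hnf hB hnP hz hl0 (by omega)
        (fun a ha b hb hab => by have := h2 a ha b hb hab; omega)
        (fun a ha y hy => by have := h1 a ha y hy; omega)

/-- **h21's cell `(2, 1)` at `|G| = 15` with no three-planar hypothesis**: no fat closure and every line of `V` with `≤ 6` or
`≥ 9` points. -/
theorem localShadowHall_fifteen_of_lines (hG : G ∈ flatsQ M (5 + 1)) (hd : (gr M \ G).card = 2)
    (hk : kColoops M G = 1) (hs : ∀ e ∈ gr M, ∀ f ∈ gr M, e ≠ f → rkN M {e, f} = 2)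
    (hl : ∀ e ∈ gr M, M.Indep {e}) (hnf : fatClosures M 5 G 2 = ∅) (h15 : G.card = 15)
    (hline : ∀ u ∈ G \ coloops M G, ∀ v ∈ G \ coloops M G, u ≠ v →
      ((G \ coloops M G) ∩ clF M {u, v}).card ≤ 6 ∨ 9 ≤ ((G \ coloops M G) ∩ clF M {u, v}).card) :
    LocalShadowHall M 5 G := by
  by_cases hlong : ∃ u ∈ G \ coloops M G, ∃ v ∈ G \ coloops M G, u ≠ v ∧ 9 ≤ ((G \ coloops M G) ∩ clF M {u, v}).card
  · obtain ⟨u, hu, v, hv, huv, h9⟩ := hlong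
    apply localShadowHall_of_long_line hG hd hk hs hl hu hv huv
    rw [card_sdiff_coloops_eq_sub_one hk]
    omega
  · push Not at hlong
    apply localShadowHall_top_of_short_lines hG hd hk hs hl hnf (Or.inl ⟨h15, rfl⟩)
    intro u hu v hv huv
    have := hlong u hu v hv huv
    rcases hline u hu v hv huv with h | h
    · exact h
    · omega

/-- **h21's cell `(2, 1)` at `|G| = 14` with no three-planar hypothesis**: no fat closure and every line of `V` with `≤ 5` or
`≥ 8` points. -/
theorem localShadowHall_fourteen_of_lines (hG : G ∈ flatsQ M (5 + 1)) (hd : (gr M \ G).card = 2)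
    (hk : kColoops M G = 1) (hs : ∀ e ∈ gr M, ∀ f ∈ gr M, e ≠ f → rkN M {e, f} = 2)
    (hl : ∀ e ∈ gr M, M.Indep {e}) (hnf : fatClosures M 5 G 2 = ∅) (h14 : G.card = 14)
    (hline : ∀ u ∈ G \ coloops M G, ∀ v ∈ G \ coloops M G, u ≠ v →
      ((G \ coloops M G) ∩ clF M {u, v}).card ≤ 5 ∨ 8 ≤ ((G \ coloops M G) ∩ clF M {u, v}).card) :
    LocalShadowHall M 5 G := by
  by_cases hlong : ∃ u ∈ G \ coloops M G, ∃ v ∈ G \ coloops M G, u ≠ v ∧ 8 ≤ ((G \ coloops M G) ∩ clF M {u, v}).card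
  · obtain ⟨u, hu, v, hv, huv, h8⟩ := hlong
    apply localShadowHall_of_long_line hG hd hk hs hl hu hv huv
    rw [card_sdiff_coloops_eq_sub_one hk]
    omega
  · push Not at hlong
    apply localShadowHall_top_of_short_lines hG hd hk hs hl hnf (Or.inr ⟨h14, rfl⟩)
    intro u hu v hv huv
    have := hlong u hu v hv huv
    rcases hline u hu v hv huv with h | h
    · exact h
    · omega

end PercRepro.Shadow
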